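import Literature.AlgebraicGeometry.HodgeTheory.VHSDataHodgeGenericPointsTateTwist
import Literature.AlgebraicGeometry.HodgeTheory.VHSDataHodgeClassesAlongSubvariations
import Literature.AlgebraicGeometry.HodgeTheory.VHSDataNonGenericHodgeClassesDescent
import Literature.AlgebraicGeometry.Motives.FamiliesVHSBidual
import HarnessLib

/-!
# Hodge-generic points do not see duality: the exceptional Hodge loci, the numbers of (generic) Hodge tensors, the Cattani–Deligne–Kaplan loci and the
# isotriviality of `T^{a,b}(D^∨)` are those of `T^{b,a}(D)`, those of `D^∨∨` are those of `D`, and `hodgeGenericLocus (D^∨) = hodgeGenericLocus D`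

Topic `Literature/AlgebraicGeometry/HodgeTheory` (namespace `Literature.AlgebraicGeometry.Motives.VHSData`), lane `lit-hodgefound` (seat `p08`, row g63-#2);
the junction of `Motives/FamiliesVHSBidual` (the biduality isomorphism `Iso.bidual : D ≅ (D^∨∨).cast`, an isometry, and `Iso.dualTensorSpace :
T^{a,b}(D^∨) ≅ (T^{b,a}D).cast`) with the loci of this series: `VHSDataHodgeClassesAlongPathsDescent` (`Iso.exceptionalHodgeLocus_eq`),
`VHSDataHodgeClassesAlongPathsTensorConstructions` (`exceptionalHodgeLocus_cast`, `genericHodgeClasses_cast`), `VHSDataHodgeClassesAlongSubvariations`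
(`Hom.comap_appRat_genericHodgeClasses`), `VHSDataNonGenericHodgeClassesDescent` (`Iso.nonGenericHodgeLocus_eq`), `VHSDataHodgeGenericPoints ∕ …Descent ∕
…TateTwist` (`hodgeGenericLocus`, `Iso.hodgeGenericLocus_eq`, `hodgeGenericLocus_cast`, `nonGenericHodgeLocus_cast`), `VHSDataIsotrivialVariations`
(`Iso.isIsotrivial_iff`, `IsIsotrivial.dual`).  THEOREMS ONLY — no definition, no named fact, no instance (D-0026 net debt `0`).

PRINTED SOURCES.  M. Green, P. Griffiths, M. Kerr, *Mumford–Tate Groups and Domains* (2012), §I.C (held text p0042: the tensor spaces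
`T^{k,l} := V^{⊗k} ⊗ V̌^{⊗l}`, the Hodge tensors `Hg^{k,l;p}`; (I.C.5): the Mumford–Tate group is the subgroup «pointwise fixing `Hg^{k,l;p}` (for all
`k,l,p`)» — a family of conditions visibly symmetric under `V ↔ V̌`, `(k,l) ↔ (l,k)`) and Ch. III, (III.2) (Hodge-generic points: the spaces of Hodge
tensors are invariant under continuation along paths); P. Deligne, *Hodge cycles on abelian varieties*, LNM 900 (1982), I §3, 3.1 (held text p0038: the
tensor spaces `T = V^{⊗m₁} ⊗ (V^∨)^{⊗m₂}`); P. Deligne, J. Milne, *Tannakian categories*, LNM 900, §1 Def. 1.7 (held text p0087: every object is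
reflexive, `i_X : X ⥲ X^∨∨`); C. Voisin, *Hodge Theory II*, §5.3.1 Def. 5.12, §5.3.3 (the Hodge loci `U_λ^p`); E. Cattani, P. Deligne, A. Kaplan, *On the
locus of Hodge classes*, J. AMS 8 (1995), §1 (p. 483), Thm. 1.1 and Cor. 1.3 (p. 484); J. Carlson, S. Müller-Stach, C. Peters, *Period Mappings and Period
Domains* (2nd ed. 2017), Lemma 13.1.8 (isotrivial = locally constant period map).

CONTENT (`D : VHSData S k`; `e : Iso D₁ D₂`).
* §1 ISOMORPHISMS PRESERVE THE NUMBERS OF (GENERIC) HODGE CLASSES: `Iso.map_appRat_hodgeClasses` (`e_ℚ(Hdg^p V₁,s) = Hdg^p V₂,s`), `Iso.finrank_hodgeClasses_eq`,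
  `Iso.map_appRat_genericHodgeClasses` (`e_ℚ(Gen^p_s(D₁)) = Gen^p_s(D₂)`), `Iso.finrank_genericHodgeClasses_eq`; with a weight cast on the target
  (`Iso.exceptionalHodgeLocus_eq_of_cast`, `Iso.hodgeGenericLocus_eq_of_cast`, `Iso.isIsotrivial_iff_of_cast`, `Iso.nonGenericHodgeLocus_eq_of_cast`).
* §2 THE DOUBLE DUAL: `exceptionalHodgeLocus_dual_dual`, `finrank_hodgeClasses_dual_dual`, `finrank_genericHodgeClasses_dual_dual`, `nonGenericHodgeLocus_dual_dual`,
  **`hodgeGenericLocus_dual_dual`**, `isIsotrivial_dual_dual_iff`, **`isIsotrivial_dual_iff`** (`D^∨` is isotrivial iff `D` is).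
* §3 THE TENSOR SPACES OF THE DUAL: **`exceptionalHodgeLocus_dual_tensorSpace`** (`exc(T^{a,b}(D^∨))_p = exc(T^{b,a}D)_p`), `finrank_hodgeClasses_dual_tensorSpace`,
  `finrank_genericHodgeClasses_dual_tensorSpace`, `nonGenericHodgeLocus_dual_tensorSpace`, `hodgeGenericLocus_dual_tensorSpace`, `isIsotrivial_dual_tensorSpace_iff`.
* §4 **`hodgeGenericLocus_dual`** (`hodgeGenericLocus (D^∨) = hodgeGenericLocus D`: A POINT IS HODGE-GENERIC FOR `D^∨` IFF IT IS FOR `D` — the family of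
  conditions «no exceptional Hodge tensor in `T^{a,b}`, `2p = (a−b)·weight`» is carried to itself by `(a,b) ↦ (b,a)`), `mem_hodgeGenericLocus_dual_iff`,
  `hodgeGenericLocus_tateTwist_dual`, `hodgeGenericLocus_hom_unit` (`Hom(D, ℤ_S)` has the Hodge-generic points of `D`),
  `isHodgeAlong_univ_dual_tensorSpace_of_mem_hodgeGenericLocus` (at a Hodge-generic point of `D` every integral Hodge tensor of every `T^{a,b}(D^∨)` is generic).

HONEST SCOPE.  Bookkeeping only: every statement is the transport of an already-landed statement along the isomorphisms `Iso.bidual`, `Iso.dualTensorSpace`,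
`Iso.tensorUnit` and the weight casts; nothing is said about `Hom(D₁, D₂)` versus `Hom(D₂, D₁)` (which needs `(D₁ ⊗ D₂)^∨ ≅ D₁^∨ ⊗ D₂^∨`, not yet in the tree).

## References

* [GreenGriffithsKerr2012] M. Green, P. Griffiths, M. Kerr, *Mumford–Tate Groups and Domains*, Ann. of Math. Studies 183 (2012), §I.C, (I.C.5); Ch. III, (III.2).
* [Deligne1982HodgeCycles] P. Deligne, *Hodge cycles on abelian varieties*, LNM 900 (1982), I §3, 3.1 (p. 38 of the volume).
* [DeligneMilne1982Tannakian] P. Deligne, J. S. Milne, *Tannakian categories*, in LNM 900 (1982), §1 Def. 1.7 (p. 87 of the volume).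
* [VoisinHodgeII2003] C. Voisin, *Hodge Theory and Complex Algebraic Geometry II*, CUP (2003), §5.3.1 Def. 5.12, §5.3.3.
* [CattaniDeligneKaplan1995] E. Cattani, P. Deligne, A. Kaplan, *On the locus of Hodge classes*, J. AMS 8 (1995), §1 (p. 483), Thm. 1.1, Cor. 1.3 (p. 484).
* [CarlsonMullerStachPeters2017] J. Carlson, S. Müller-Stach, C. Peters, *Period Mappings and Period Domains*, 2nd ed., CUP (2017), Lemma 13.1.8.
* [DeligneHodgeII1971] P. Deligne, *Théorie de Hodge II*, Publ. Math. IHÉS 40 (1971), 1.1.6, Thm. 2.3.5.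
-/

noncomputable section

open scoped TensorProduct
open _root_.Topology _root_.Filter Set

universe u

namespace Literature.AlgebraicGeometry

open Motives Motives.HodgeStructure HodgeTheory Topology

namespace Motives.VHSData

variable {S : Type} [TopologicalSpace S] {k k' : ℤ}

/-! ## §1 Isomorphic VHS data have the same numbers of Hodge classes and of generic Hodge classes -/

section Iso

variable {D₁ D₂ : VHSData S k}

/-- **An isomorphism carries `Hdg^p(V₁,s)` ONTO `Hdg^p(V₂,s)`** (`hom` and `inv` are morphisms of Hodge structures). [cite: VoisinHodgeII2003, §5.3.1] [cite: DeligneHodgeII1971, 1.1.6] -/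
theorem Iso.map_appRat_hodgeClasses (e : Iso D₁ D₂) (p : ℤ) (s : S) :
    ((D₁.hodge s).hodgeClasses p).map (e.hom.appRat s) = (D₂.hodge s).hodgeClasses p := by
  ext y
  rw [Submodule.mem_map]
  constructor
  · rintro ⟨x, hx, rfl⟩
    exact (e.hom.hodgeHom s).apply_mem_hodgeClasses hx
  · intro hy
    exact ⟨e.inv.appRat s y, (e.inv.hodgeHom s).apply_mem_hodgeClasses hy, e.hom_appRat_inv_appRat s y⟩

/-- **Isomorphic VHS data have the same number of Hodge classes of each level at each point.** [cite: VoisinHodgeII2003, §5.3.1] [cite: GreenGriffithsKerr2012, §I.C] -/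
theorem Iso.finrank_hodgeClasses_eq (e : Iso D₁ D₂) (p : ℤ) (s : S) :
    Module.finrank ℚ ((D₁.hodge s).hodgeClasses p) = Module.finrank ℚ ((D₂.hodge s).hodgeClasses p) :=
  (LinearEquiv.ofSubmodules (LinearEquiv.ofLinear (e.hom.appRat s) (e.inv.appRat s) (e.hom_appRat_comp_inv_appRat s) (e.inv_appRat_comp_hom_appRat s))
    _ _ (e.map_appRat_hodgeClasses p s)).finrank_eq

/-- **An isomorphism carries the generic classes `Gen^p_s(D₁)` ONTO `Gen^p_s(D₂)`** (it commutes with the transports and identifies the Hodge classes at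
every endpoint). [cite: VoisinHodgeII2003, §5.3.1 Def. 5.12] [cite: CattaniDeligneKaplan1995, §1 (p. 483)] -/
theorem Iso.map_appRat_genericHodgeClasses (e : Iso D₁ D₂) (p : ℤ) (s : S) :
    (D₁.genericHodgeClasses p s).map (e.hom.appRat s) = D₂.genericHodgeClasses p s := by
  rw [← e.hom.comap_appRat_genericHodgeClasses e.hom_app_injective p s]
  exact Submodule.map_comap_eq_of_surjective (fun y => ⟨e.inv.appRat s y, e.hom_appRat_inv_appRat s y⟩) _

/-- **Isomorphic VHS data have the same number of GENERIC Hodge classes of each level at each point.** [cite: VoisinHodgeII2003, §5.3.1 Def. 5.12]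
[cite: GreenGriffithsKerr2012, Ch. III, (III.2)] -/
theorem Iso.finrank_genericHodgeClasses_eq (e : Iso D₁ D₂) (p : ℤ) (s : S) :
    Module.finrank ℚ (D₁.genericHodgeClasses p s) = Module.finrank ℚ (D₂.genericHodgeClasses p s) :=
  (LinearEquiv.ofSubmodules (LinearEquiv.ofLinear (e.hom.appRat s) (e.inv.appRat s) (e.hom_appRat_comp_inv_appRat s) (e.inv_appRat_comp_hom_appRat s))
    _ _ (e.map_appRat_genericHodgeClasses p s)).finrank_eq

/-! ### Isomorphisms onto a weight cast -/

variable {D : VHSData S k} {D' : VHSData S k'}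

/-- `exc(D)_p = exc(D')_p` for `D ≅ D'.cast h`. [cite: VoisinHodgeII2003, §5.3.1 Def. 5.12] -/
theorem Iso.exceptionalHodgeLocus_eq_of_cast {h : k' = k} (e : Iso D (D'.cast h)) (p : ℤ) : D.exceptionalHodgeLocus p = D'.exceptionalHodgeLocus p := by
  rw [e.exceptionalHodgeLocus_eq p, exceptionalHodgeLocus_cast]

/-- `dim Hdg^p(V_s) = dim Hdg^p(V'_s)` for `D ≅ D'.cast h`. [cite: GreenGriffithsKerr2012, §I.C] -/
theorem Iso.finrank_hodgeClasses_eq_of_cast {h : k' = k} (e : Iso D (D'.cast h)) (p : ℤ) (s : S) :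
    Module.finrank ℚ ((D.hodge s).hodgeClasses p) = Module.finrank ℚ ((D'.hodge s).hodgeClasses p) := by
  rw [e.finrank_hodgeClasses_eq p s]
  rfl

/-- `dim Gen^p_s(D) = dim Gen^p_s(D')` for `D ≅ D'.cast h`. [cite: GreenGriffithsKerr2012, Ch. III, (III.2)] -/
theorem Iso.finrank_genericHodgeClasses_eq_of_cast {h : k' = k} (e : Iso D (D'.cast h)) (p : ℤ) (s : S) :
    Module.finrank ℚ (D.genericHodgeClasses p s) = Module.finrank ℚ (D'.genericHodgeClasses p s) := by
  rw [e.finrank_genericHodgeClasses_eq p s, genericHodgeClasses_cast]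
  rfl

/-- `E(D; p, K) = E(D'; p, K)` for an ISOMETRIC `D ≅ D'.cast h`. [cite: CattaniDeligneKaplan1995, §1 (p. 484)] -/
theorem Iso.nonGenericHodgeLocus_eq_of_cast {h : k' = k} (e : Iso D (D'.cast h)) (he : e.hom.IsIsometry) (p K : ℤ) :
    D.nonGenericHodgeLocus p K = D'.nonGenericHodgeLocus p K := by
  rw [e.nonGenericHodgeLocus_eq he p K, nonGenericHodgeLocus_cast]

/-- `hodgeGenericLocus D = hodgeGenericLocus D'` for `D ≅ D'.cast h`. [cite: GreenGriffithsKerr2012, Ch. III, (III.2)] -/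
theorem Iso.hodgeGenericLocus_eq_of_cast {h : k' = k} (e : Iso D (D'.cast h)) : D.hodgeGenericLocus = D'.hodgeGenericLocus := by
  rw [e.hodgeGenericLocus_eq, hodgeGenericLocus_cast]

/-- `D` is isotrivial iff `D'` is, for `D ≅ D'.cast h`. [cite: CarlsonMullerStachPeters2017, Lemma 13.1.8] -/
theorem Iso.isIsotrivial_iff_of_cast {h : k' = k} (e : Iso D (D'.cast h)) : D.IsIsotrivial ↔ D'.IsIsotrivial := by
  rw [e.isIsotrivial_iff, isIsotrivial_cast_iff]

end Iso

/-! ## §2 The double dual `D^∨∨` has the loci of `D` -/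

section DualDual

variable (D : VHSData S k)

/-- **`exc(D^∨∨)_p = exc(D)_p`.** [cite: VoisinHodgeII2003, §5.3.1 Def. 5.12] [cite: DeligneMilne1982Tannakian, §1 Def. 1.7 (LNM 900 p0087)] -/
theorem exceptionalHodgeLocus_dual_dual (p : ℤ) : D.dual.dual.exceptionalHodgeLocus p = D.exceptionalHodgeLocus p :=
  ((Iso.bidual D).exceptionalHodgeLocus_eq_of_cast p).symm

/-- `dim Hdg^p(V_s^∨∨) = dim Hdg^p(V_s)`. [cite: GreenGriffithsKerr2012, §I.C] [cite: DeligneMilne1982Tannakian, §1 Def. 1.7 (LNM 900 p0087)] -/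
theorem finrank_hodgeClasses_dual_dual (p : ℤ) (s : S) :
    Module.finrank ℚ ((D.dual.dual.hodge s).hodgeClasses p) = Module.finrank ℚ ((D.hodge s).hodgeClasses p) :=
  ((Iso.bidual D).finrank_hodgeClasses_eq_of_cast p s).symm

/-- `dim Gen^p_s(D^∨∨) = dim Gen^p_s(D)`. [cite: GreenGriffithsKerr2012, Ch. III, (III.2)] [cite: DeligneMilne1982Tannakian, §1 Def. 1.7 (LNM 900 p0087)] -/
theorem finrank_genericHodgeClasses_dual_dual (p : ℤ) (s : S) :
    Module.finrank ℚ (D.dual.dual.genericHodgeClasses p s) = Module.finrank ℚ (D.genericHodgeClasses p s) :=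
  ((Iso.bidual D).finrank_genericHodgeClasses_eq_of_cast p s).symm

/-- **`E(D^∨∨; p, K) = E(D; p, K)`** (`i_D` is an isometric isomorphism). [cite: CattaniDeligneKaplan1995, §1 (p. 484)] [cite: DeligneMilne1982Tannakian, §1 Def. 1.7 (LNM 900 p0087)] -/
theorem nonGenericHodgeLocus_dual_dual (p K : ℤ) : D.dual.dual.nonGenericHodgeLocus p K = D.nonGenericHodgeLocus p K :=
  ((Iso.bidual D).nonGenericHodgeLocus_eq_of_cast (Iso.isIsometry_bidual_hom D) p K).symm

/-- **`hodgeGenericLocus (D^∨∨) = hodgeGenericLocus D`.** [cite: GreenGriffithsKerr2012, Ch. III, (III.2)] [cite: DeligneMilne1982Tannakian, §1 Def. 1.7 (LNM 900 p0087)] -/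
theorem hodgeGenericLocus_dual_dual : D.dual.dual.hodgeGenericLocus = D.hodgeGenericLocus :=
  (Iso.bidual D).hodgeGenericLocus_eq_of_cast.symm

/-- `D^∨∨` is isotrivial iff `D` is. [cite: CarlsonMullerStachPeters2017, Lemma 13.1.8] [cite: DeligneMilne1982Tannakian, §1 Def. 1.7 (LNM 900 p0087)] -/
theorem isIsotrivial_dual_dual_iff : D.dual.dual.IsIsotrivial ↔ D.IsIsotrivial :=
  (Iso.bidual D).isIsotrivial_iff_of_cast.symm

/-- **`D^∨` IS ISOTRIVIAL IFF `D` IS** (the transports of `D^∨` are the contragredients; back through `D^∨∨ ≅ D`). [cite: CarlsonMullerStachPeters2017, Lemma 13.1.8]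
[cite: DeligneHodgeII1971, 1.1.6] -/
theorem isIsotrivial_dual_iff : D.dual.IsIsotrivial ↔ D.IsIsotrivial :=
  ⟨fun h => (isIsotrivial_dual_dual_iff D).1 h.dual, fun h => h.dual⟩

end DualDual

/-! ## §3 The tensor spaces of the dual: `T^{a,b}(D^∨)` has the loci of `T^{b,a}(D)` -/

section DualTensorSpace

variable (D : VHSData S k)

/-- **`exc(T^{a,b}(D^∨))_p = exc(T^{b,a}D)_p`**: the exceptional Hodge loci of the tensor variations of `D^∨` are exceptional Hodge loci of tensor variations
of `D` (`T^{a,b}(D^∨) ≅ T^{b,a}(D)`). [cite: GreenGriffithsKerr2012, §I.C] [cite: VoisinHodgeII2003, §5.3.1 Def. 5.12] [cite: Deligne1982HodgeCycles, I §3, 3.1 (LNM 900 p0038)] -/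
theorem exceptionalHodgeLocus_dual_tensorSpace (a b : ℕ) (p : ℤ) :
    (D.dual.tensorSpace a b).exceptionalHodgeLocus p = (D.tensorSpace b a).exceptionalHodgeLocus p :=
  (Iso.dualTensorSpace D a b).exceptionalHodgeLocus_eq_of_cast p

/-- `dim Hdg^p(T^{a,b}V_s^∨) = dim Hdg^p(T^{b,a}V_s)` — the Hodge tensors of `V̌` of type `(k,l)` are the Hodge tensors of `V` of type `(l,k)`.
[cite: GreenGriffithsKerr2012, §I.C, (I.C.5)] [cite: Deligne1982HodgeCycles, I §3, 3.1 (LNM 900 p0038)] -/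
theorem finrank_hodgeClasses_dual_tensorSpace (a b : ℕ) (p : ℤ) (s : S) :
    Module.finrank ℚ (((D.dual.tensorSpace a b).hodge s).hodgeClasses p) = Module.finrank ℚ (((D.tensorSpace b a).hodge s).hodgeClasses p) :=
  (Iso.dualTensorSpace D a b).finrank_hodgeClasses_eq_of_cast p s

/-- `dim Gen^p_s(T^{a,b}(D^∨)) = dim Gen^p_s(T^{b,a}D)`. [cite: GreenGriffithsKerr2012, Ch. III, (III.2)] [cite: VoisinHodgeII2003, §5.3.1 Def. 5.12] -/
theorem finrank_genericHodgeClasses_dual_tensorSpace (a b : ℕ) (p : ℤ) (s : S) :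
    Module.finrank ℚ ((D.dual.tensorSpace a b).genericHodgeClasses p s) = Module.finrank ℚ ((D.tensorSpace b a).genericHodgeClasses p s) :=
  (Iso.dualTensorSpace D a b).finrank_genericHodgeClasses_eq_of_cast p s

/-- **`E(T^{a,b}(D^∨); p, K) = E(T^{b,a}D; p, K)`** (`Iso.dualTensorSpace` is isometric). [cite: CattaniDeligneKaplan1995, §1 (p. 484)] [cite: GreenGriffithsKerr2012, §I.C] -/
theorem nonGenericHodgeLocus_dual_tensorSpace (a b : ℕ) (p K : ℤ) :
    (D.dual.tensorSpace a b).nonGenericHodgeLocus p K = (D.tensorSpace b a).nonGenericHodgeLocus p K :=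
  (Iso.dualTensorSpace D a b).nonGenericHodgeLocus_eq_of_cast (Iso.isIsometry_dualTensorSpace_hom D a b) p K

/-- `hodgeGenericLocus (T^{a,b}(D^∨)) = hodgeGenericLocus (T^{b,a}D)`. [cite: GreenGriffithsKerr2012, Ch. III, (III.2)] -/
theorem hodgeGenericLocus_dual_tensorSpace (a b : ℕ) : (D.dual.tensorSpace a b).hodgeGenericLocus = (D.tensorSpace b a).hodgeGenericLocus :=
  (Iso.dualTensorSpace D a b).hodgeGenericLocus_eq_of_cast

/-- `T^{a,b}(D^∨)` is isotrivial iff `T^{b,a}(D)` is. [cite: CarlsonMullerStachPeters2017, Lemma 13.1.8] -/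
theorem isIsotrivial_dual_tensorSpace_iff (a b : ℕ) : (D.dual.tensorSpace a b).IsIsotrivial ↔ (D.tensorSpace b a).IsIsotrivial :=
  (Iso.dualTensorSpace D a b).isIsotrivial_iff_of_cast

end DualTensorSpace

/-! ## §4 Hodge-genericity does not see duality -/

section HodgeGeneric

variable (D : VHSData S k)

/-- **`hodgeGenericLocus (D^∨) = hodgeGenericLocus D`: A POINT IS HODGE-GENERIC FOR `D^∨` IFF IT IS HODGE-GENERIC FOR `D`** — the exceptional loci of the
`T^{a,b}(D^∨)` at the levels `2p = (a−b)(−k)` are exactly the exceptional loci of the `T^{b,a}D` at the levels `2p = (b−a)k`.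
[cite: GreenGriffithsKerr2012, §I.C, (I.C.5) and Ch. III, (III.2)] [cite: Deligne1982HodgeCycles, I §3, 3.1 (LNM 900 p0038)] -/
theorem hodgeGenericLocus_dual : D.dual.hodgeGenericLocus = D.hodgeGenericLocus := by
  ext s
  simp only [mem_hodgeGenericLocus_iff]
  constructor
  · intro h a b p hp hs
    refine h b a p (by linear_combination hp) ?_
    rwa [exceptionalHodgeLocus_dual_tensorSpace]
  · intro h a b p hp hs
    rw [exceptionalHodgeLocus_dual_tensorSpace] at hs
    exact h b a p (by linear_combination hp) hs

/-- Pointwise form. [cite: GreenGriffithsKerr2012, Ch. III, (III.2)] -/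
theorem mem_hodgeGenericLocus_dual_iff (s : S) : s ∈ D.dual.hodgeGenericLocus ↔ s ∈ D.hodgeGenericLocus := by
  rw [hodgeGenericLocus_dual]

/-- `hodgeGenericLocus ((D^∨)(j)) = hodgeGenericLocus D`. [cite: GreenGriffithsKerr2012, Ch. III, (III.2)] [cite: DeligneHodgeII1971, 1.1.6] -/
theorem hodgeGenericLocus_tateTwist_dual (j : ℤ) : (D.dual.tateTwist j).hodgeGenericLocus = D.hodgeGenericLocus := by
  rw [hodgeGenericLocus_tateTwist, hodgeGenericLocus_dual]

/-- `hodgeGenericLocus ((D(j))^∨) = hodgeGenericLocus D`. [cite: GreenGriffithsKerr2012, Ch. III, (III.2)] [cite: DeligneHodgeII1971, 1.1.6] -/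
theorem hodgeGenericLocus_dual_tateTwist' (j : ℤ) : (D.tateTwist j).dual.hodgeGenericLocus = D.hodgeGenericLocus := by
  rw [hodgeGenericLocus_dual_tateTwist, hodgeGenericLocus_dual]

/-- **`Hom(D, ℤ_S)` has the Hodge-generic points of `D`** (`Hom(D, ℤ_S) = (D^∨ ⊗ ℤ_S).cast ≅ D^∨`, `Iso.tensorUnit`). [cite: GreenGriffithsKerr2012, Ch. III, (III.2)]
[cite: DeligneMilne1982Tannakian, §1 (LNM 900 p0087)] -/
theorem hodgeGenericLocus_hom_unit : (D.hom (unit S)).hodgeGenericLocus = D.hodgeGenericLocus := by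
  rw [hom, hodgeGenericLocus_cast, (Iso.tensorUnit D.dual).hodgeGenericLocus_eq_of_cast, hodgeGenericLocus_dual]

/-- The tensor variations of the double dual: `hodgeGenericLocus (T^{a,b}(D^∨∨)) = hodgeGenericLocus (T^{a,b}D)`. [cite: GreenGriffithsKerr2012, Ch. III, (III.2)] -/
theorem hodgeGenericLocus_dual_dual_tensorSpace (a b : ℕ) : (D.dual.dual.tensorSpace a b).hodgeGenericLocus = (D.tensorSpace a b).hodgeGenericLocus := by
  rw [hodgeGenericLocus_dual_tensorSpace, hodgeGenericLocus_dual_tensorSpace]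

/-- **At a Hodge-generic point of `D`, every integral Hodge tensor of `D^∨` (every class of type `(p,p)` of any `T^{a,b}(D^∨)`, `2p = (b−a)k`) is generic.**
[cite: GreenGriffithsKerr2012, Ch. III, (III.2)] [cite: CattaniDeligneKaplan1995, §1 (p. 483)] -/
theorem isHodgeAlong_univ_dual_tensorSpace_of_mem_hodgeGenericLocus {s : S} (hs : s ∈ D.hodgeGenericLocus) (a b : ℕ) {p : ℤ}
    (hp : p + p = (a : ℤ) * (-k) + (b : ℤ) * (-(-k))) {u : (D.dual.tensorSpace a b).VZ.fiber s} (hu : (D.dual.tensorSpace a b).IsHodgeAt s p u) :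
    (D.dual.tensorSpace a b).IsHodgeAlong p u univ :=
  D.dual.isHodgeAlong_univ_of_mem_hodgeGenericLocus ((D.mem_hodgeGenericLocus_dual_iff s).2 hs) a b hp hu

/-- Conversely phrased: off the exceptional locus of `T^{b,a}D` there is no exceptional Hodge tensor in `T^{a,b}(D^∨)`. [cite: GreenGriffithsKerr2012, Ch. III, (III.2)] -/
theorem not_mem_exceptionalHodgeLocus_dual_tensorSpace_iff (a b : ℕ) (p : ℤ) (s : S) :
    s ∉ (D.dual.tensorSpace a b).exceptionalHodgeLocus p ↔ s ∉ (D.tensorSpace b a).exceptionalHodgeLocus p := by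
  rw [exceptionalHodgeLocus_dual_tensorSpace]

end HodgeGeneric

end Motives.VHSData

end Literature.AlgebraicGeometry

end
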